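import Summits.HodgeConjecture.HodgeConjecture.Theorems.F0P3ArchStructureOfT3              -- ★-to-be E2 (A-p14 (g26)): §2 finite blocks, T3 shapes; brings ★ E1, D, C, B′, B
import HarnessLib

/-!
# L-adm(K∞) ⟸ T3 — `ArchLevelAdmissible` is a THEOREM on the compact quotient (ROAD E FILE E3; A-p14 (g26), 2026-09-01)

Cell `hodgecm-mathlib`, programme P3 «U3-mult», ROAD «TF».  ★ FILE D types the letter `ArchLevelAdmissible` (L-adm at `K∞`: for every `cptTriv₀` class `c`, every compact
open level `K′`, the level-`K′` block `B` of `rep c` and every descent `σB` of `B` to `U(2,1)`, the Harish-Chandra module of `σB` is admissible [BorelJacquet1979 §4.3]) and ★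
FILE C consumes it.  THIS FILE PROVES IT from **T3 = Harish-Chandra admissibility of the IRREDUCIBLE closed `G′_∞`-blocks** (★ E2's hypothesis shape, fed by the named fact ★
`GKModules.isAdmissibleGK_of_irreducible_unitary` via ★ `t3Blocks_of_isAdmissibleGK_of_irreducible_unitary`) on the COMPACT quotient (`hdef`, `h2`):

* §1 `isAdmissibleGK_of_forall_eq_zero` — a `K`-module mapping into FINITELY MANY admissible `K`-modules by a JOINTLY INJECTIVE family of `K`-maps is admissible
  (`Hom_K(τ,V) ↪ Π_i Hom_K(τ,V_i)`).
* §2 **`archLevelAdmissible_of_t3`** `: hdef → h2 → ‹T3 at blocks› → ArchLevelAdmissible L H ι T hT μ` — the level-`K′` block `B` is the finite orthogonal sum of irreducible closed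
  blocks `W_i` (★ E1 + ★ E2 §2, fed by ★ B′ `liso_of_isAdmissibleGK` and T3); the orthogonal projections `B → W_i` commute with `G′_∞` (★ `starProjection_map_apply`), hence induce
  `K∞`-maps of Harish-Chandra modules `HC(σB) → HC(σ_i)` (★ `Intertwiner.harishChandraMap`), jointly injective since `⨆ W_i = B`; each `HC(σ_i)` is admissible by T3; §1.
* §3 `archLevelAdmissible_of_isAdmissibleGK_of_irreducible_unitary` — the same with T3 supplied BY NAME (`∀ σ, isAdmissibleGK_of_irreducible_unitary U(2,1) σ`).

CONSEQUENCE FOR THE BOOKS: with ★ D `archBlockStructure_of_core_of_adm` this gives a second derivation of ★ E2's `archBlockStructure_of_core_of_t3`; either way the (H) block reads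
H3 ⟸ {H3-core, T3} (+ `hdef`, `h2`) and `ArchLevelAdmissible` is NOT a letter.  THEOREMS ONLY; no definition, no instance, no notation, no named fact, no `sorry`.  NON-CLAIMS: T3
itself (Harish-Chandra 1953 Thms. 4–6 for `U(2,1)`) is not proved here.  HONEST LABEL: HC_CM is proved only modulo the 2 remaining named inputs (hLiu418, h413) until rung 0 closes.

## References
* Harish-Chandra, *Representations of a semisimple Lie group on a Banach space I*, Trans. AMS 75 (1953), §9 Thms. 4–6 (p. 224) [HarishChandraTAMS1953].
* A. Borel, H. Jacquet, *Automorphic forms and automorphic representations*, Corvallis 1979, part 1, §4.3 (admissibility of the archimedean modules of automorphic forms) and §4.6 [BorelJacquet1979].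
* N. Wallach, *Real Reductive Groups I* (1988), §3.3.1–§3.3.4 (functoriality of `K`-finite smooth vectors) [WallachRRG1].
* A. Deitmar, S. Echterhoff, *Principles of Harmonic Analysis*, 2nd ed. (2014), Thm. 9.2.2 [DeitmarEchterhoff2014].
-/

-- Mathlib idiom (as in ★ `GKModules`): commutator bracket, needed to MENTION `GKIrrClass (uFormGroup …)` ∕ `IsUnitaryGlobalization` ∕ `harishChandraRepK`.
attribute [local instance 100] LieRing.ofAssociativeRing

set_option autoImplicit false
-- the mandated namespace repeats `HodgeConjecture.HodgeConjecture`, as in every `Theorems/*.lean` of this sub-problem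
set_option linter.dupNamespace false

noncomputable section

open MeasureTheory Measure NumberField CompactlySupported Topology
open Literature.NumberTheory.Automorphic Literature.NumberTheory.Automorphic.UnitaryGroup
open Literature.NumberTheory.Automorphic.UnitaryGroup.CotangentForms
open Literature.RepresentationTheory Literature.RepresentationTheory.KonnoKonno2007 Literature.RepresentationTheory.KonnoKonno2007.RealDualPair
open Literature.RepresentationTheory.BorelWallach2000
open scoped Matrix InnerProductSpace ENNReal ComplexOrder

namespace Summit.HodgeConjecture.HodgeConjecture.Cruxes.H413.F0P3ArchLevelAdmissibleOfT3

open Summit.HodgeConjecture.HodgeConjecture.Cruxes.H413.F0P3InnerFormClassificationV6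
open Summit.HodgeConjecture.HodgeConjecture.Cruxes.H413.F0P3ClassTokensOfRecord (Cls rep)
open Summit.HodgeConjecture.HodgeConjecture.Cruxes.H413.F0P3CompactTrivOfRecord (cptTriv₀)
open Summit.HodgeConjecture.HodgeConjecture.Cruxes.H413.F0P3UnitaryLocOfRecord (clInfChoiceU)
open Summit.HodgeConjecture.HodgeConjecture.Cruxes.H413.F0P3bArchDegOneClass (archDegOneClass)
open Summit.HodgeConjecture.HodgeConjecture.Cruxes.H413.F0P3LettersArchBlockCoreAdm (ArchLevelAdmissible archLevelAdmissible_iff)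
open Summit.HodgeConjecture.HodgeConjecture.Cruxes.H413.F0P3ArchTraceOfRealisation (exists_descend_archProjUForm)
open Summit.HodgeConjecture.HodgeConjecture.Cruxes.H413.F0P3ArchStructureLetterSplit (exists_descend_toContRep isUnitaryGlobalization_of_descend_of_areUnitarilyEquivalent toContRep_eq_one_of_cptTriv₀)
open Summit.HodgeConjecture.HodgeConjecture.Cruxes.H413.F0P3ArchIsotypyOfAdmissibleBlock (liso_of_isAdmissibleGK)
open Summit.HodgeConjecture.HodgeConjecture.Cruxes.H413.F0P3HolProjectionReduction (compactSpace_automorphicQuotient_cm)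
open Summit.HodgeConjecture.HodgeConjecture.Cruxes.H413.F0P3ArchStructureOfT3 (t3Blocks_of_isAdmissibleGK_of_irreducible_unitary exists_fin_orthogonal_blocks_of_isDiscretelyDecomposable_of_descend)
open ContRepresentation (ClosedSubrep AreUnitarilyEquivalent)

/-! ## §1 Admissibility from a jointly injective finite family of `K`-maps -/

/-- **A `K`-module that maps into finitely many admissible `K`-modules by a jointly injective family of `K`-maps is admissible**: `S ↦ (T_i ∘ S)_i` embeds `Hom_K(τ, V)` into the
finite-dimensional `Π_i Hom_K(τ, V_i)`. [cite: WallachRRG1, §3.3.1] [cite: BorelJacquet1979, §4.3] -/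
theorem isAdmissibleGK_of_forall_eq_zero {n : ℕ} {V : Type*} [AddCommGroup V] [Module ℂ V] {Vi : Fin n → Type*} [∀ i, AddCommGroup (Vi i)] [∀ i, Module ℂ (Vi i)]
    {ρ : Representation ℂ (uFormGroup (Fin 2) (Fin 1)).maximalCompact V} {ρi : ∀ i, Representation ℂ (uFormGroup (Fin 2) (Fin 1)).maximalCompact (Vi i)}
    (Tm : ∀ i, ρ.IntertwiningMap (ρi i)) (hT : ∀ v, (∀ i, Tm i v = 0) → v = 0) (h : ∀ i, IsAdmissibleGK (ρi i)) : IsAdmissibleGK ρ := by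
  intro W _ _ _ τ hτ
  haveI : ∀ i, FiniteDimensional ℂ (τ.IntertwiningMap (ρi i)) := fun i => h i W τ hτ
  refine Module.Finite.of_injective (LinearMap.pi fun i => Representation.IntertwiningMap.llcomp τ ρ (ρi i) (Tm i)) fun S₁ S₂ hS => ?_
  refine Representation.IntertwiningMap.ext (LinearMap.ext fun w => ?_)
  rw [← sub_eq_zero]
  refine hT _ fun i => ?_
  have hi : Tm i (S₁.toLinearMap w) = Tm i (S₂.toLinearMap w) := congrArg (fun S : ∀ i, τ.IntertwiningMap (ρi i) => S i w) hS
  rw [map_sub, hi, sub_self]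

/-! ## §2 `ArchLevelAdmissible` from T3 at the blocks -/

variable (L : Type) [Field L] [NumberField L] [IsCMField L] (H : Matrix (Fin 3) (Fin 3) L) (ι : L →+* ℂ) (T : GL (Fin 3) ℂ)
  (hT : (T : Matrix (Fin 3) (Fin 3) ℂ)ᴴ * H.map ι * (T : Matrix (Fin 3) (Fin 3) ℂ) = Literature.Geometry.ComplexHyperbolic.BallModel.J)
  (μ : Measure (Gp L H).automorphicQuotient) [(Gp L H).IsAutomorphicMeasure μ]

-- nested subtype carriers `H_K^∞(σB) ⊆ B ⊆ L²` and `W_i ⊆ L²`: the declaration-level `whnf` exceeds 1.6M (measured, instances pinned); passes at 3.2M in < 50 s wall (as ★ C)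
set_option maxHeartbeats 3200000 in
/-- **L-adm(K∞) FROM T3** (`hdef`, `h2`): on the compact quotient, if every IRREDUCIBLE closed `G′_∞`-block of `L²` descending to `U(2,1)` has an admissible Harish-Chandra module (T3),
then so does every level-`K′` block `B` of every `cptTriv₀` class — `ArchLevelAdmissible` (★ D) holds.  `B = ⨁_{i<n} W_i` (★ E1, ★ E2 §2); the orthogonal projections
`B → W_i` commute with `G′_∞` and induce jointly injective `K∞`-maps `HC(σB) → HC(σ_i)`; §1. [cite: BorelJacquet1979, §4.3 and §4.6] [cite: HarishChandraTAMS1953, §9 Thm. 4 (p. 224)]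
[cite: WallachRRG1, §3.3.4] [cite: DeitmarEchterhoff2014, Thm. 9.2.2] -/
theorem archLevelAdmissible_of_t3
    (hdef : ∀ τ' : L →+* ℂ, InfinitePlace.mk τ' ≠ InfinitePlace.mk ι → (H.map τ').PosDef) (h2 : 2 ≤ Module.finrank ℚ ↥(maximalRealSubfield L))
    (hT3 : ∀ (W : ClosedSubrep (((Gp L H).rightRegular μ).restrict (archToAdelic (↥(maximalRealSubfield L)) L (IsCMField.complexConj L) 3 H)))
      (σ : ContRepresentation ℂ (uFormGroup (Fin 2) (Fin 1)).carrier W.toSubmodule), W.toContRep.IsTopIrreducible →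
      (∀ g, W.toContRep g = σ (archProjUForm L ι H T hT g)) → IsAdmissibleGK (harishChandraRepK (uFormGroup (Fin 2) (Fin 1)) σ)) :
    ArchLevelAdmissible L H ι T hT μ := by
  rw [archLevelAdmissible_iff]
  intro c hc K' hKo hKc B hBchar σB hσB
  haveI : CompactSpace (Gp L H).automorphicQuotient := compactSpace_automorphicQuotient_cm (L := L) (ι := ι) (H := H) hdef h2
  -- the ambient representation of `G′_∞` on `L²`
  have hRu : ((Gp L H).rightRegular μ).IsUnitary := (Gp L H).isUnitary_rightRegular μ
  have hRc : ((Gp L H).rightRegular μ).IsStronglyContinuous := (Gp L H).isStronglyContinuous_rightRegular_holds μ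
  have hπu : (((Gp L H).rightRegular μ).restrict (archToAdelic (↥(maximalRealSubfield L)) L (IsCMField.complexConj L) 3 H)).IsUnitary :=
    hRu.restrict _
  have hπc : (((Gp L H).rightRegular μ).restrict (archToAdelic (↥(maximalRealSubfield L)) L (IsCMField.complexConj L) 3 H)).IsStronglyContinuous :=
    hRc.restrict _ (continuous_archToAdelic (↥(maximalRealSubfield L)) L (IsCMField.complexConj L) 3 H)
  have hBle : B.toSubmodule ≤ (rep (Gp L H) μ c).space.toSubmodule := fun w hw => ((hBchar w).1 hw).1
  have hBfix : ∀ w ∈ B, ∀ k ∈ K', (Gp L H).rightRegular μ (finAdelicToAdelic (↥(maximalRealSubfield L)) L (IsCMField.complexConj L) 3 H k) w = w :=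
    fun w hw k hk => ((hBchar w).1 hw).2 k hk
  have hBu : B.toContRep.IsUnitary := hπu.toContRep B
  have hBc : B.toContRep.IsStronglyContinuous := fun v => by
    have h1 : Continuous fun g => ((B.toContRep g v : B.toSubmodule) : (Gp L H).L2 μ) := by
      simp only [ClosedSubrep.coe_toContRep_apply]
      exact hπc (v : (Gp L H).L2 μ)
    exact continuous_induced_rng.2 h1
  have hinfl_le : ∀ Wb : ClosedSubrep B.toContRep, (B.inflate Wb).toSubmodule ≤ (rep (Gp L H) μ c).space.toSubmodule :=
    fun Wb v hv => hBle ((B.inflate_le Wb) hv)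
  have hkerB : ∀ g, archProjUForm L ι H T hT g = 1 → B.toContRep g = 1 := toContRep_eq_one_of_cptTriv₀ L H ι T hT μ c hc B hBle
  -- ★ E1: `B` is discretely decomposable with finite multiplicities; ★ E2 §2: finitely many irreducible blocks exhaust `B`
  have hdB := isDiscretelyDecomposable_toContRep_of_fixed (↥(maximalRealSubfield L)) L (IsCMField.complexConj L) 3 H K' hKo hKc B hBfix
  have hmultB := multiplicity_lt_top_toContRep_of_fixed (↥(maximalRealSubfield L)) L (IsCMField.complexConj L) 3 H K' hKo hKc B hBfix
  obtain ⟨n, Wb, -, -, hirrb, -, -, htop⟩ :=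
    exists_fin_orthogonal_blocks_of_isDiscretelyDecomposable_of_descend L H ι T hT
      (x := clInfChoiceU L H ι T hT μ (archDegOneClass 1 (Or.inl rfl)) (rep (Gp L H) μ c)) hBu hdB hmultB
      (fun Wb hWb => by
        let Wr : ClosedSubrep B.toContRep := Wb
        have hirr' : (B.inflate Wr).toContRep.IsTopIrreducible := (B.isTopIrreducible_inflate_iff Wr).2 hWb
        obtain ⟨σ', hσ'⟩ := exists_descend_archProjUForm L ι H T hT (B.inflate Wr).toContRep
          (toContRep_eq_one_of_cptTriv₀ L H ι T hT μ c hc (B.inflate Wr) (hinfl_le Wr))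
        have hglob' := liso_of_isAdmissibleGK L ι H T hT (archDegOneClass 1 (Or.inl rfl)) c (B.inflate Wr) (hinfl_le Wr) hirr' σ' hσ'
          (hT3 (B.inflate Wr) σ' hirr' hσ')
        obtain ⟨σb, hσb⟩ := exists_descend_toContRep L ι H T hT hkerB Wb
        exact ⟨σb, hσb, isUnitaryGlobalization_of_descend_of_areUnitarilyEquivalent L ι H T hT hBu hBc Wb hσb hσ'
          (B.areUnitarilyEquivalent_inflate Wr).symm hglob'⟩)
  -- the blocks inflated to `L²`, their descents, and T3 on them
  let Wr : Fin n → ClosedSubrep B.toContRep := Wb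
  have hirrr : ∀ i, (Wr i).toContRep.IsTopIrreducible := hirrb
  have htopr : (⨆ i, (Wr i).toSubmodule) = ⊤ := htop
  choose σbar hσbar using fun i => exists_descend_archProjUForm L ι H T hT (B.inflate (Wr i)).toContRep
    (toContRep_eq_one_of_cptTriv₀ L H ι T hT μ c hc (B.inflate (Wr i)) (hinfl_le (Wr i)))
  have hadm : ∀ i, IsAdmissibleGK (harishChandraRepK (uFormGroup (Fin 2) (Fin 1)) (σbar i)) := fun i =>
    hT3 (B.inflate (Wr i)) (σbar i) ((B.isTopIrreducible_inflate_iff (Wr i)).2 (hirrr i)) (hσbar i)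
  -- the orthogonal projections `B → W_i` are bounded `G′_∞`-intertwiners, hence `U(2,1)`-intertwiners `σB → σbar i` (instances pinned: the search is the expensive step)
  haveI hcs : ∀ i, CompleteSpace (B.inflate (Wr i)).toSubmodule := fun i => (B.inflate (Wr i)).isClosed.completeSpace_coe
  haveI hop : ∀ i, ((B.inflate (Wr i)).toSubmodule).HasOrthogonalProjection := fun i => Submodule.HasOrthogonalProjection.ofCompleteSpace _
  let Tc : ∀ i, B.toSubmodule →L[ℂ] (B.inflate (Wr i)).toSubmodule := fun i =>
    (B.inflate (Wr i)).toSubmodule.orthogonalProjectionOnto.comp B.toSubmodule.subtypeL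
  have hTc : ∀ i (v : B.toSubmodule), ((Tc i v : (B.inflate (Wr i)).toSubmodule) : (Gp L H).L2 μ) =
      (B.inflate (Wr i)).toSubmodule.starProjection (v : (Gp L H).L2 μ) := fun i v => by
    rw [ContinuousLinearMap.comp_apply, Submodule.coe_orthogonalProjectionOnto_apply]
    rfl
  have hTg : ∀ i (g : arch (↥(maximalRealSubfield L)) L (IsCMField.complexConj L) 3 H) (v : B.toSubmodule),
      Tc i (B.toContRep g v) = (B.inflate (Wr i)).toContRep g (Tc i v) := fun i g v => by
    apply Subtype.ext
    rw [hTc, ClosedSubrep.coe_toContRep_apply, ClosedSubrep.coe_toContRep_apply, hTc]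
    exact (B.inflate (Wr i)).starProjection_map_apply hπu g (v : (Gp L H).L2 μ)
  have hTu : ∀ i (u : (uFormGroup (Fin 2) (Fin 1)).carrier) (v : B.toSubmodule), Tc i (σB u v) = σbar i u (Tc i v) := fun i u v => by
    obtain ⟨g, rfl⟩ := archProjUForm_surjective L ι H T hT u
    rw [← hσB, ← hσbar i]
    exact hTg i g v
  let T₁ : ∀ i, (harishChandraRepK (uFormGroup (Fin 2) (Fin 1)) σB).IntertwiningMap (harishChandraRepK (uFormGroup (Fin 2) (Fin 1)) (σbar i)) := fun i =>
    { toLinearMap := Intertwiner.harishChandraMap (uFormGroup (Fin 2) (Fin 1)) (hTu i)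
      isIntertwining' := fun k => LinearMap.ext fun v => Intertwiner.harishChandraMap_repK (uFormGroup (Fin 2) (Fin 1)) (hTu i) k v }
  refine isAdmissibleGK_of_forall_eq_zero T₁ (fun v hv => ?_) hadm
  -- joint injectivity: `P_{W_i} v = 0` for all `i` and `v ∈ B = ⨆ W_i` force `v = 0`
  have hv0 : ∀ i, (B.inflate (Wr i)).toSubmodule.starProjection ((v : B.toSubmodule) : (Gp L H).L2 μ) = 0 := fun i => by
    have h1 : ((Intertwiner.harishChandraMap (uFormGroup (Fin 2) (Fin 1)) (hTu i) v : (B.inflate (Wr i)).toSubmodule) : (Gp L H).L2 μ) = 0 := by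
      have h0 : (T₁ i v : harishChandraSpace (uFormGroup (Fin 2) (Fin 1)) (σbar i)) = 0 := hv i
      rw [Subtype.ext_iff] at h0
      rw [Subtype.ext_iff] at h0
      exact h0
    rw [Intertwiner.coe_harishChandraMap_apply, hTc] at h1
    exact h1
  have hvorth : ((v : B.toSubmodule) : (Gp L H).L2 μ) ∈ (⨆ i, (B.inflate (Wr i)).toSubmodule)ᗮ := by
    rw [← Submodule.iInf_orthogonal, Submodule.mem_iInf]
    intro i
    exact (Submodule.starProjection_apply_eq_zero_iff _).1 (hv0 i)
  have hvmem : ((v : B.toSubmodule) : (Gp L H).L2 μ) ∈ ⨆ i, (B.inflate (Wr i)).toSubmodule := by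
    have h1 : (v : B.toSubmodule) ∈ ⨆ i, (Wr i).toSubmodule := by rw [htopr]; exact Submodule.mem_top
    have h2' : ((v : B.toSubmodule) : (Gp L H).L2 μ) ∈ (⨆ i, (Wr i).toSubmodule).map B.toSubmodule.subtype := ⟨(v : B.toSubmodule), h1, rfl⟩
    rw [Submodule.map_iSup] at h2'
    simpa only [ClosedSubrep.toSubmodule_inflate] using h2'
  have hvz : ((v : B.toSubmodule) : (Gp L H).L2 μ) = 0 := by
    have h := Submodule.inf_orthogonal_eq_bot (⨆ i, (B.inflate (Wr i)).toSubmodule)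
    rw [Submodule.eq_bot_iff] at h
    exact h _ ⟨hvmem, hvorth⟩
  exact Subtype.ext (Subtype.ext hvz)

/-! ## §3 The same with T3 BY NAME -/

/-- **`ArchLevelAdmissible` FROM HARISH-CHANDRA'S ADMISSIBILITY THEOREM BY NAME** (`hdef`, `h2`): the named fact ★ `isAdmissibleGK_of_irreducible_unitary` at `U(2,1)` (hypothesis
`∀ σ, …`) gives T3 at the blocks (★ E2 `t3Blocks_of_isAdmissibleGK_of_irreducible_unitary`), hence L-adm(K∞). [cite: HarishChandraTAMS1953, §9 Thms. 4–6 (p. 224)]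
[cite: BorelJacquet1979, §4.3] -/
theorem archLevelAdmissible_of_isAdmissibleGK_of_irreducible_unitary
    (hdef : ∀ τ' : L →+* ℂ, InfinitePlace.mk τ' ≠ InfinitePlace.mk ι → (H.map τ').PosDef) (h2 : 2 ≤ Module.finrank ℚ ↥(maximalRealSubfield L))
    (hT3 : ∀ {E : Type} [NormedAddCommGroup E] [InnerProductSpace ℂ E] [CompleteSpace E]
      (σ : ContRepresentation ℂ (uFormGroup (Fin 2) (Fin 1)).carrier E), isAdmissibleGK_of_irreducible_unitary (uFormGroup (Fin 2) (Fin 1)) σ) :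
    ArchLevelAdmissible L H ι T hT μ :=
  archLevelAdmissible_of_t3 L H ι T hT μ hdef h2 fun W σ hirr hσ => t3Blocks_of_isAdmissibleGK_of_irreducible_unitary L H ι T hT μ hT3 W σ hirr hσ

end Summit.HodgeConjecture.HodgeConjecture.Cruxes.H413.F0P3ArchLevelAdmissibleOfT3

end
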